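import Summits.CriticalPhenomena.SAWScalingLimit.Theorems.SAWDefectDecoherenceBoundaryClosureRBoundaryExactnessZigzag
import Summits.CriticalPhenomena.SAWScalingLimit.Theorems.SAWDefectDecoherenceBoundaryClosureRBoundaryExactnessPhase
import HarnessLib

/-!
# Boundary exactness of the SAW developing map, III: straight gate (E3), root arms (E4), the stub

Route `SAWDefectDecoherence`, crux `BoundaryClosureR` (stmt-CriticalPhenomena-14004), line
`pick-half-plane`, registered stub `stub_boundaryExactness` = (E2) ∧ (E3) ∧ (E4), the exact
boundary data of the developing map `H` (`dH = F dz`) along flat floors, stated with the line's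
abbreviations `upFace k m = (k,m,0)`, `belowFace k m = (k,m-1,1)`, `floorEdge k m`, `IsFlatFloor`
unfolded.  All three clauses are winding RIGIDITY between boundary mid-edges of a simply connected
domain (`boundaryWindingRigidity_proof`) plus explicit walks:

* (E3) `straightGate`: walks from a boundary root to any two floor edges of a flat floor not
  containing the root have equal windings — cut a walk at its FIRST visit to three consecutive
  floor faces and reroute it to either neighbouring floor edge (`exists_two_exits`: from each of the
  three possible entrances the two exits turn by the same amount), then induct along the floor;
* (E4) `rootArms`: from a floor root, floor edges to the east receive winding `-π`, to the west
  `+π` (`exists_floor_walks`);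
* (E2) `boundaryPhaseLaw` is the companion file `…BoundaryExactnessPhase`.
-/

noncomputable section

open Literature.Probability.LatticeModels Literature.Probability.RandomPlanarGeometry.SAW
open Literature.Probability.RandomPlanarGeometry.SAW.HV

namespace Summit.CriticalPhenomena.SAWScalingLimit.Theorems.PickHalfPlane.BoundaryExactness

variable {Λ : Finset HexVertex}

/-! ### Two exits from the first visit to a flat floor -/

/-- **Two exits with equal windings.** Let `(j,m,0), (j,m,1), (j+1,m,0) ∈ Λ` be three
consecutive faces of a flat floor (the faces below `(j,m,0)` and `(j+1,m,0)` lie off `Λ`) and let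
`δ` be a walk from a boundary root `{u, w}`, different from the two floor edges, that meets one
of the three faces. Cutting `δ` at its first visit and continuing along the floor gives a walk to
the floor edge below `(j,m,0)` and a walk to the floor edge below `(j+1,m,0)` WITH THE SAME
WINDING: from each of the three possible entrances (`(j-1,m,1) → (j,m,0)` at heading `-30°`,
`(j,m+1,0) → (j,m,1)` at `-90°`, `(j+1,m,1) → (j+1,m,0)` at `-150°`) the two exits, both leaving
downwards, turn by the same total amount. [folklore] -/
theorem exists_two_exits {u w : HexVertex} {z : Sym2 HexVertex} {j m : ℤ}
    (hu : u ∉ Λ) (huw : hexGraph.Adj u w)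
    (hU0 : ((![j, m], 0) : HexVertex) ∈ Λ) (hM : ((![j, m], 1) : HexVertex) ∈ Λ)
    (hU1 : ((![j + 1, m], 0) : HexVertex) ∈ Λ)
    (hB0 : ((![j, m - 1], 1) : HexVertex) ∉ Λ) (hB1 : ((![j + 1, m - 1], 1) : HexVertex) ∉ Λ)
    (ha0 : s(u, w) ≠ s(((![j, m - 1], 1) : HexVertex), ((![j, m], 0) : HexVertex)))
    (ha1 : s(u, w) ≠ s(((![j + 1, m - 1], 1) : HexVertex), ((![j + 1, m], 0) : HexVertex)))
    (δ : HexMidEdgeSAW Λ s(u, w) z)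
    (hvis : ∃ v ∈ δ.verts, v ∈ [((![j, m], 0) : HexVertex), (![j, m], 1), (![j + 1, m], 0)]) :
    ∃ (γ₀ : HexMidEdgeSAW Λ s(u, w) s(((![j, m - 1], 1) : HexVertex), ((![j, m], 0) : HexVertex)))
      (γ₁ : HexMidEdgeSAW Λ s(u, w)
        s(((![j + 1, m - 1], 1) : HexVertex), ((![j + 1, m], 0) : HexVertex))),
      γ₁.winding = γ₀.winding := by
  classical
  obtain ⟨A, zv, B, hsplit, hzv, hA⟩ := exists_first_mem_split' _ δ.verts hvis
  have hne : δ.verts ≠ [] := by rw [hsplit]; simp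
  have hhead : δ.verts.head hne = w := δ.head_eq rfl hu hne
  -- lattice facts
  have aB0U0 : hexGraph.Adj ((![j, m - 1], 1) : HexVertex) (![j, m], 0) := by
    rw [hexGraph_adj_iff_coord]; simp
  have aB1U1 : hexGraph.Adj ((![j + 1, m - 1], 1) : HexVertex) (![j + 1, m], 0) := by
    rw [hexGraph_adj_iff_coord]; simp
  have aU0M : hexGraph.Adj ((![j, m], 0) : HexVertex) (![j, m], 1) := by
    rw [hexGraph_adj_iff_coord]; simp
  have aMU1 : hexGraph.Adj ((![j, m], 1) : HexVertex) (![j + 1, m], 0) := by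
    rw [hexGraph_adj_iff_coord]; simp
  -- the vertex before the first visit
  obtain ⟨p, hp⟩ : ∃ p, (u :: A).getLast (List.cons_ne_nil _ _) = p := ⟨_, rfl⟩
  have hpadj : hexGraph.Adj p zv := by
    have hch : ((u :: A) ++ zv :: B).IsChain hexGraph.Adj := by
      rw [List.cons_append]
      refine List.isChain_cons.2 ⟨fun y hy => ?_, hsplit ▸ δ.isChain⟩
      have h1 : (A ++ zv :: B).head? = some w := by
        rw [← hhead, ← List.head?_eq_some_head hne, hsplit]
      rw [h1, Option.mem_def, Option.some_inj] at hy
      rw [← hy]; exact huw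
    rw [← hp]
    exact hch.rel_getLast_head_of_append (List.cons_ne_nil _ _) (List.cons_ne_nil _ _)
  have hp_or : p = u ∨ p ∈ A := by
    by_cases hA0 : A = []
    · left; rw [← hp]; simp [hA0]
    · right; rw [← hp, List.getLast_cons hA0]; exact List.getLast_mem hA0
  have hpZ : ∀ x : HexVertex, x ∈ Λ →
      x ∈ [((![j, m], 0) : HexVertex), (![j, m], 1), (![j + 1, m], 0)] → p ≠ x := by
    rintro x hxΛ hxZ rfl
    rcases hp_or with h | h
    · exact hu (h ▸ hxΛ)
    · exact hA _ h hxZ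
  have hpU0 : p ≠ (![j, m], 0) := hpZ _ hU0 (by simp)
  have hpM : p ≠ (![j, m], 1) := hpZ _ hM (by simp)
  have hpU1 : p ≠ (![j + 1, m], 0) := hpZ _ hU1 (by simp)
  -- `p` is off `Λ` only if `p = u`, `A = []`, and then the first visit is `w`
  have hpout : ∀ x : HexVertex, x ∉ Λ → p = x → u = x ∧ zv = w := by
    intro x hx hpx
    rcases hp_or with h | h
    · refine ⟨h ▸ hpx, ?_⟩
      have hA0 : A = [] := by
        by_contra hA0
        rw [← hp, List.getLast_cons hA0] at h
        exact hu (δ.subset u (by rw [hsplit]; exact List.mem_append_left _ (h ▸ List.getLast_mem hA0)))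
      rw [← hhead]; simp [hsplit, hA0]
    · exact absurd (δ.subset p (by rw [hsplit]; exact List.mem_append_left _ h)) (hpx ▸ hx)
  have hAS : ∀ S : List HexVertex,
      (∀ x ∈ S, x ∈ [((![j, m], 0) : HexVertex), (![j, m], 1), (![j + 1, m], 0)]) →
      ∀ x ∈ A, x ∉ S := fun S hS x hx hxS => hA x hx (hS x hxS)
  simp only [List.mem_cons, List.not_mem_nil, or_false] at hzv
  rcases hzv with rfl | rfl | rfl
  · -- first visit at the up face `(j,m,0)`: entered from `(j-1,m,1)`
    have hpc : toHV p = (j - 1, m, true) := by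
      rcases (hexGraph_adj_iff_coord p.1 (![j, m]) p.2 0).1 hpadj with ⟨-, h10, -⟩ | ⟨h2, -, h01⟩
      · exact absurd h10 (by decide)
      simp only [Matrix.cons_val_zero, Matrix.cons_val_one] at h01
      rcases h01 with ⟨h0, h1⟩ | ⟨h0, h1⟩ | ⟨h0, h1⟩
      · exact absurd (eq_mk_of_coord h0 h1 h2) hpM
      · rw [toHV_of_coord h0 h1 h2]; rfl
      · obtain ⟨hux, hzw⟩ := hpout _ hB0 (eq_mk_of_coord h0 h1 h2)
        exact absurd (by rw [hux, ← hzw]) ha0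
    obtain ⟨γ₀, h₀⟩ := exists_extend hu huw δ hsplit [] (![j, m - 1], 1) (![j, m], 0)
      (by simpa using hU0) (List.nodup_singleton _) (List.isChain_singleton _)
      (hAS _ (by simp)) rfl hB0 aB0U0 ha0
    obtain ⟨γ₁, h₁⟩ := exists_extend hu huw δ hsplit [(![j, m], 1), (![j + 1, m], 0)]
      (![j + 1, m - 1], 1) (![j + 1, m], 0)
      (by simp only [List.mem_cons, List.not_mem_nil, or_false]
          rintro x (rfl | rfl | rfl) <;> assumption)
      (by simp)
      (List.isChain_cons_cons.2 ⟨aU0M, List.isChain_pair.2 aMU1⟩)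
      (hAS _ (by simp)) rfl hB1 aB1U1 ha1
    refine ⟨γ₀, γ₁, ?_⟩
    rw [hp] at h₀ h₁
    rw [h₀, h₁, hpc]
    simp
  · -- first visit at the down face `(j,m,1)`: entered from above, `(j,m+1,0)`
    have hpc : toHV p = (j, m + 1, false) := by
      rcases (hexGraph_adj_iff_coord p.1 (![j, m]) p.2 1).1 hpadj with ⟨h2, -, h01⟩ | ⟨-, h10, -⟩
      swap
      · exact absurd h10 (by decide)
      simp only [Matrix.cons_val_zero, Matrix.cons_val_one] at h01
      rcases h01 with ⟨h0, h1⟩ | ⟨h0, h1⟩ | ⟨h0, h1⟩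
      · exact absurd (eq_mk_of_coord h0.symm h1.symm h2) hpU0
      · exact absurd (eq_mk_of_coord (c := j + 1) (by omega) h1.symm h2) hpU1
      · rw [toHV_of_coord (c := j) (d := m + 1) (by omega) (by omega) h2]; rfl
    obtain ⟨γ₀, h₀⟩ := exists_extend hu huw δ hsplit [(![j, m], 0)] (![j, m - 1], 1) (![j, m], 0)
      (by simp only [List.mem_cons, List.not_mem_nil, or_false]
          rintro x (rfl | rfl) <;> assumption)
      (by simp) (List.isChain_pair.2 aU0M.symm)
      (hAS _ (by simp)) rfl hB0 aB0U0 ha0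
    obtain ⟨γ₁, h₁⟩ := exists_extend hu huw δ hsplit [(![j + 1, m], 0)] (![j + 1, m - 1], 1)
      (![j + 1, m], 0)
      (by simp only [List.mem_cons, List.not_mem_nil, or_false]
          rintro x (rfl | rfl) <;> assumption)
      (by simp) (List.isChain_pair.2 aMU1)
      (hAS _ (by simp)) rfl hB1 aB1U1 ha1
    refine ⟨γ₀, γ₁, ?_⟩
    rw [hp] at h₀ h₁
    rw [h₀, h₁, hpc]
    simp
  · -- first visit at the up face `(j+1,m,0)`: entered from `(j+1,m,1)`
    have hpc : toHV p = (j + 1, m, true) := by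
      rcases (hexGraph_adj_iff_coord p.1 (![j + 1, m]) p.2 0).1 hpadj with
        ⟨-, h10, -⟩ | ⟨h2, -, h01⟩
      · exact absurd h10 (by decide)
      simp only [Matrix.cons_val_zero, Matrix.cons_val_one] at h01
      rcases h01 with ⟨h0, h1⟩ | ⟨h0, h1⟩ | ⟨h0, h1⟩
      · rw [toHV_of_coord h0 h1 h2]; rfl
      · exact absurd (eq_mk_of_coord (c := j) (by omega) h1 h2) hpM
      · obtain ⟨hux, hzw⟩ := hpout _ hB1 (eq_mk_of_coord h0 h1 h2)
        exact absurd (by rw [hux, ← hzw]) ha1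
    obtain ⟨γ₀, h₀⟩ := exists_extend hu huw δ hsplit [(![j, m], 1), (![j, m], 0)]
      (![j, m - 1], 1) (![j, m], 0)
      (by simp only [List.mem_cons, List.not_mem_nil, or_false]
          rintro x (rfl | rfl | rfl) <;> assumption)
      (by simp)
      (List.isChain_cons_cons.2 ⟨aMU1.symm, List.isChain_pair.2 aU0M.symm⟩)
      (hAS _ (by simp)) rfl hB0 aB0U0 ha0
    obtain ⟨γ₁, h₁⟩ := exists_extend hu huw δ hsplit [] (![j + 1, m - 1], 1) (![j + 1, m], 0)
      (by simpa using hU1) (List.nodup_singleton _) (List.isChain_singleton _)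
      (hAS _ (by simp)) rfl hB1 aB1U1 ha1
    refine ⟨γ₀, γ₁, ?_⟩
    rw [hp] at h₀ h₁
    rw [h₀, h₁, hpc]
    simp

/-! ### (E3) The straight gate -/

/-- **One step east along a flat floor.** Let `(k,m,0), (k,m,1), (k',m,0) ∈ Λ`, `k' = k + 1`, with
the faces below `(k,m,0)` and `(k',m,0)` off `Λ`, and let the boundary root `{u, w}` be neither
of the two floor edges. For every walk from the root to the floor edge below `(k,m,0)` there is
a walk to the floor edge below `(k',m,0)` with the same winding: the walk meets the three faces,
`exists_two_exits` reroutes it both ways with equal windings, and the winding at the first floor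
edge is rigid. [folklore] -/
theorem exists_step_east (hΛ : hexDomainSimplyConnected Λ) {u w : HexVertex}
    (huw : hexGraph.Adj u w) (hu : u ∉ Λ) (hw : w ∈ Λ) {k k' m : ℤ} (hk' : k' = k + 1)
    (hU0 : ((![k, m], 0) : HexVertex) ∈ Λ) (hM : ((![k, m], 1) : HexVertex) ∈ Λ)
    (hU1 : ((![k', m], 0) : HexVertex) ∈ Λ)
    (hB0 : ((![k, m - 1], 1) : HexVertex) ∉ Λ) (hB1 : ((![k', m - 1], 1) : HexVertex) ∉ Λ)
    (ha0 : s(u, w) ≠ s(((![k, m - 1], 1) : HexVertex), ((![k, m], 0) : HexVertex)))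
    (ha1 : s(u, w) ≠ s(((![k', m - 1], 1) : HexVertex), ((![k', m], 0) : HexVertex)))
    (δ₀ : HexMidEdgeSAW Λ s(u, w) s(((![k, m - 1], 1) : HexVertex), ((![k, m], 0) : HexVertex))) :
    ∃ δ₁ : HexMidEdgeSAW Λ s(u, w) s(((![k', m - 1], 1) : HexVertex), ((![k', m], 0) : HexVertex)),
      δ₁.winding = δ₀.winding := by
  subst hk'
  have hb0 := mk_mem_hexDomainBoundary (Λ := Λ) (by rw [hexGraph_adj_iff_coord]; simp) hB0 hU0
  have hne : δ₀.verts ≠ [] := fun h => ha0 (δ₀.eq_of_nil h)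
  have hvis : ∃ v ∈ δ₀.verts,
      v ∈ [((![k, m], 0) : HexVertex), (![k, m], 1), (![k + 1, m], 0)] := by
    refine ⟨_, List.getLast_mem hne, ?_⟩
    rcases δ₀.getLast_eq_or hne with h | h
    · exact absurd (h ▸ δ₀.subset _ (List.getLast_mem hne)) hB0
    · rw [h]; simp
  obtain ⟨γ₀, γ₁, hγ⟩ := exists_two_exits hu huw hU0 hM hU1 hB0 hB1 ha0 ha1 δ₀ hvis
  exact ⟨γ₁, by rw [hγ, boundaryWindingRigidity_proof Λ hΛ _ (mk_mem_hexDomainBoundary huw hu hw)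
    _ hb0 γ₀ δ₀]⟩

/-- **One step west along a flat floor**: the same data, from a walk to the floor edge below
`(k',m,0)` to a walk to the floor edge below `(k,m,0)` with the same winding. [folklore] -/
theorem exists_step_west (hΛ : hexDomainSimplyConnected Λ) {u w : HexVertex}
    (huw : hexGraph.Adj u w) (hu : u ∉ Λ) (hw : w ∈ Λ) {k k' m : ℤ} (hk' : k' = k + 1)
    (hU0 : ((![k, m], 0) : HexVertex) ∈ Λ) (hM : ((![k, m], 1) : HexVertex) ∈ Λ)
    (hU1 : ((![k', m], 0) : HexVertex) ∈ Λ)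
    (hB0 : ((![k, m - 1], 1) : HexVertex) ∉ Λ) (hB1 : ((![k', m - 1], 1) : HexVertex) ∉ Λ)
    (ha0 : s(u, w) ≠ s(((![k, m - 1], 1) : HexVertex), ((![k, m], 0) : HexVertex)))
    (ha1 : s(u, w) ≠ s(((![k', m - 1], 1) : HexVertex), ((![k', m], 0) : HexVertex)))
    (δ₁ : HexMidEdgeSAW Λ s(u, w) s(((![k', m - 1], 1) : HexVertex), ((![k', m], 0) : HexVertex))) :
    ∃ δ₀ : HexMidEdgeSAW Λ s(u, w) s(((![k, m - 1], 1) : HexVertex), ((![k, m], 0) : HexVertex)),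
      δ₀.winding = δ₁.winding := by
  subst hk'
  have hb1 := mk_mem_hexDomainBoundary (Λ := Λ) (by rw [hexGraph_adj_iff_coord]; simp) hB1 hU1
  have hne : δ₁.verts ≠ [] := fun h => ha1 (δ₁.eq_of_nil h)
  have hvis : ∃ v ∈ δ₁.verts,
      v ∈ [((![k, m], 0) : HexVertex), (![k, m], 1), (![k + 1, m], 0)] := by
    refine ⟨_, List.getLast_mem hne, ?_⟩
    rcases δ₁.getLast_eq_or hne with h | h
    · exact absurd (h ▸ δ₁.subset _ (List.getLast_mem hne)) hB1
    · rw [h]; simp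
  obtain ⟨γ₀, γ₁, hγ⟩ := exists_two_exits hu huw hU0 hM hU1 hB0 hB1 ha0 ha1 δ₁ hvis
  exact ⟨γ₀, by rw [← hγ, boundaryWindingRigidity_proof Λ hΛ _ (mk_mem_hexDomainBoundary huw hu hw)
    _ hb1 γ₁ δ₁]⟩

/-- **(E3) The straight gate.** On a flat floor `k₁ ≤ k ≤ k₂` of row `m` of a simply connected `Λ`
(up faces `(k,m,0) ∈ Λ`, the faces `(k,m-1,1)` below them off `Λ`, the down faces `(k,m,1)`,
`k < k₂`, in `Λ`) none of whose floor edges is the boundary root `{u, w}`, the walks from the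
root to any two floor edges of the floor have the same winding: starting from `γb`, step one
column at a time towards `ke` keeping the winding (`exists_step_east` / `exists_step_west`),
and compare with `γe` by rigidity. [folklore] -/
theorem straightGate (Λ : Finset HexVertex) (hΛ : hexDomainSimplyConnected Λ)
    (u w : HexVertex) (huw : hexGraph.Adj u w) (hu : u ∉ Λ) (hw : w ∈ Λ) (m k₁ k₂ : ℤ)
    (hF : ∀ k : ℤ, k₁ ≤ k → k ≤ k₂ → ((![k, m], 0) : HexVertex) ∈ Λ ∧
      ((![k, m - 1], 1) : HexVertex) ∉ Λ ∧ (k < k₂ → ((![k, m], 1) : HexVertex) ∈ Λ))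
    (hroot : ∀ k : ℤ, k₁ ≤ k → k ≤ k₂ →
      s(((![k, m - 1], 1) : HexVertex), ((![k, m], 0) : HexVertex)) ≠ s(u, w))
    (kb ke : ℤ) (hkb₁ : k₁ ≤ kb) (hkb₂ : kb ≤ k₂) (hke₁ : k₁ ≤ ke) (hke₂ : ke ≤ k₂)
    (γb : HexMidEdgeSAW Λ s(u, w) s(((![kb, m - 1], 1) : HexVertex), ((![kb, m], 0) : HexVertex)))
    (γe : HexMidEdgeSAW Λ s(u, w) s(((![ke, m - 1], 1) : HexVertex), ((![ke, m], 0) : HexVertex))) :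
    γe.winding = γb.winding := by
  have ha := mk_mem_hexDomainBoundary huw hu hw
  have hbe : s(((![ke, m - 1], 1) : HexVertex), ((![ke, m], 0) : HexVertex)) ∈ hexDomainBoundary Λ :=
    mk_mem_hexDomainBoundary (by rw [hexGraph_adj_iff_coord]; simp) (hF ke hke₁ hke₂).2.1
      (hF ke hke₁ hke₂).1
  rcases le_or_gt kb ke with hle | hlt
  · -- step east from `kb` to `ke`
    have key : ∀ k, kb ≤ k → k ≤ ke → ∃ δ : HexMidEdgeSAW Λ s(u, w)
        s(((![k, m - 1], 1) : HexVertex), ((![k, m], 0) : HexVertex)), δ.winding = γb.winding := by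
      intro k hk
      induction k, hk using Int.leInduction with
      | base => exact fun _ => ⟨γb, rfl⟩
      | succ k hk ih =>
        intro hk1
        obtain ⟨δ, hδ⟩ := ih (by omega)
        have h0 := hF k (by omega) (by omega)
        have h1 := hF (k + 1) (by omega) (by omega)
        obtain ⟨δ₁, hδ₁⟩ := exists_step_east hΛ huw hu hw rfl h0.1 (h0.2.2 (by omega)) h1.1
          h0.2.1 h1.2.1 (hroot k (by omega) (by omega)).symm
          (hroot (k + 1) (by omega) (by omega)).symm δ
        exact ⟨δ₁, hδ₁.trans hδ⟩
    obtain ⟨δ, hδ⟩ := key ke hle le_rfl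
    rw [← hδ]
    exact boundaryWindingRigidity_proof Λ hΛ _ ha _ hbe γe δ
  · -- step west from `kb` to `ke`
    have key : ∀ k, k ≤ kb → ke ≤ k → ∃ δ : HexMidEdgeSAW Λ s(u, w)
        s(((![k, m - 1], 1) : HexVertex), ((![k, m], 0) : HexVertex)), δ.winding = γb.winding := by
      intro k hk
      induction k, hk using Int.leInductionDown with
      | base => exact fun _ => ⟨γb, rfl⟩
      | pred k hk ih =>
        intro hk1
        obtain ⟨δ, hδ⟩ := ih (by omega)
        have h0 := hF (k - 1) (by omega) (by omega)
        have h1 := hF k (by omega) (by omega)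
        obtain ⟨δ₀, hδ₀⟩ := exists_step_west hΛ huw hu hw (k := k - 1) (k' := k) (by ring) h0.1
          (h0.2.2 (by omega)) h1.1 h0.2.1 h1.2.1 (hroot (k - 1) (by omega) (by omega)).symm
          (hroot k (by omega) (by omega)).symm δ
        exact ⟨δ₀, hδ₀.trans hδ⟩
    obtain ⟨δ, hδ⟩ := key ke hlt.le le_rfl
    rw [← hδ]
    exact boundaryWindingRigidity_proof Λ hΛ _ ha _ hbe γe δ

/-! ### (E4) The root arms -/

/-- **(E4) The root arms.** For a root sitting ON a flat floor of a simply connected `Λ` (the floor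
edge below `(ka,m,0)`), every walk to a floor edge of the same floor to the EAST has winding `-π`
and to the WEST `+π`: by rigidity it suffices to compute the winding of one explicit walk in each
direction (`exists_floor_walks`). [folklore] -/
theorem rootArms (Λ : Finset HexVertex) (hΛ : hexDomainSimplyConnected Λ) (m k₁ k₂ ka : ℤ)
    (hF : ∀ k : ℤ, k₁ ≤ k → k ≤ k₂ → ((![k, m], 0) : HexVertex) ∈ Λ ∧
      ((![k, m - 1], 1) : HexVertex) ∉ Λ ∧ (k < k₂ → ((![k, m], 1) : HexVertex) ∈ Λ))
    (hka₁ : k₁ ≤ ka) (hka₂ : ka ≤ k₂) (ke : ℤ) (hke₁ : k₁ ≤ ke) (hke₂ : ke ≤ k₂)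
    (γ : HexMidEdgeSAW Λ s(((![ka, m - 1], 1) : HexVertex), ((![ka, m], 0) : HexVertex))
      s(((![ke, m - 1], 1) : HexVertex), ((![ke, m], 0) : HexVertex))) :
    (ka < ke → γ.winding = -Real.pi) ∧ (ke < ka → γ.winding = Real.pi) := by
  have hbd : ∀ k, k₁ ≤ k → k ≤ k₂ →
      s(((![k, m - 1], 1) : HexVertex), ((![k, m], 0) : HexVertex)) ∈ hexDomainBoundary Λ :=
    fun k h1 h2 => mk_mem_hexDomainBoundary (by rw [hexGraph_adj_iff_coord]; simp)
      (hF k h1 h2).2.1 (hF k h1 h2).1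
  constructor
  · intro hlt
    obtain ⟨⟨Z, hZ⟩, -⟩ := exists_floor_walks hF hka₁ hke₂ hlt
    rw [← hZ]
    exact boundaryWindingRigidity_proof Λ hΛ _ (hbd ka hka₁ hka₂) _ (hbd ke hke₁ hke₂) γ Z
  · intro hlt
    obtain ⟨-, Z, hZ⟩ := exists_floor_walks hF hke₁ hka₂ hlt
    rw [← hZ]
    exact boundaryWindingRigidity_proof Λ hΛ _ (hbd ka hka₁ hka₂) _ (hbd ke hke₁ hke₂) γ Z

/-! ### The registered stub -/

/-- **STUB `stub_boundaryExactness` of the line `pick-half-plane` (crux `BoundaryClosureR`,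
stmt-CriticalPhenomena-14004)**: the boundary exactness of the developing map — (E2) the boundary
phase law, (E3) the straight gate, (E4) the root arms — stated with the line-local abbreviations
`upFace k m = (k,m,0)`, `belowFace k m = (k,m-1,1)`, `floorEdge k m = {belowFace, upFace}` and
`IsFlatFloor` unfolded, so that `exact stub_boundaryExactness` closes the skeleton's stub.
[folklore] -/
theorem stub_boundaryExactness :
    (∀ (Λ : Finset HexVertex), hexDomainSimplyConnected Λ →
      ∀ (u w : HexVertex), hexGraph.Adj u w → u ∉ Λ → w ∈ Λ →
      ∀ (u' w' : HexVertex), hexGraph.Adj u' w' → u' ∉ Λ → w' ∈ Λ → s(u', w') ≠ s(u, w) →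
      ∀ γ : HexMidEdgeSAW Λ s(u, w) s(u', w'),
        (hexMidpoint s(u', w') - hexCenter w') *
            hexParafermionicObservable Λ s(u, w) hexCriticalFugacity (5 / 8) s(u', w') =
          (hexCenter w - hexCenter u) / 2 *
              Complex.exp (Complex.I * (3 / 8 : ℂ) * (γ.winding : ℂ)) *
            (‖hexParafermionicObservable Λ s(u, w) hexCriticalFugacity 0 s(u', w')‖ : ℂ)) ∧
    (∀ (Λ : Finset HexVertex), hexDomainSimplyConnected Λ →
      ∀ (u w : HexVertex), hexGraph.Adj u w → u ∉ Λ → w ∈ Λ →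
      ∀ (m k₁ k₂ : ℤ), (∀ k : ℤ, k₁ ≤ k → k ≤ k₂ →
          ((![k, m], 0) : HexVertex) ∈ Λ ∧ ((![k, m - 1], 1) : HexVertex) ∉ Λ ∧
            (k < k₂ → ((![k, m], 1) : HexVertex) ∈ Λ)) →
        (∀ k : ℤ, k₁ ≤ k → k ≤ k₂ →
          s(((![k, m - 1], 1) : HexVertex), ((![k, m], 0) : HexVertex)) ≠ s(u, w)) →
      ∀ (kb ke : ℤ), k₁ ≤ kb → kb ≤ k₂ → k₁ ≤ ke → ke ≤ k₂ →
      ∀ (γb : HexMidEdgeSAW Λ s(u, w)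
          s(((![kb, m - 1], 1) : HexVertex), ((![kb, m], 0) : HexVertex)))
        (γe : HexMidEdgeSAW Λ s(u, w)
          s(((![ke, m - 1], 1) : HexVertex), ((![ke, m], 0) : HexVertex))),
        γe.winding = γb.winding) ∧
    (∀ (Λ : Finset HexVertex), hexDomainSimplyConnected Λ →
      ∀ (m k₁ k₂ ka : ℤ), (∀ k : ℤ, k₁ ≤ k → k ≤ k₂ →
          ((![k, m], 0) : HexVertex) ∈ Λ ∧ ((![k, m - 1], 1) : HexVertex) ∉ Λ ∧
            (k < k₂ → ((![k, m], 1) : HexVertex) ∈ Λ)) → k₁ ≤ ka → ka ≤ k₂ →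
      ∀ (ke : ℤ), k₁ ≤ ke → ke ≤ k₂ →
      ∀ γ : HexMidEdgeSAW Λ s(((![ka, m - 1], 1) : HexVertex), ((![ka, m], 0) : HexVertex))
          s(((![ke, m - 1], 1) : HexVertex), ((![ke, m], 0) : HexVertex)),
        (ka < ke → γ.winding = -Real.pi) ∧ (ke < ka → γ.winding = Real.pi)) :=
  ⟨boundaryPhaseLaw, straightGate, rootArms⟩

end Summit.CriticalPhenomena.SAWScalingLimit.Theorems.PickHalfPlane.BoundaryExactness
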